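import Literature.NumberTheory.Automorphic.GLnTwoBlockUnipotentChangeOfVariables
import Literature.NumberTheory.Automorphic.GLnLeviQuotientIwasawaIntegration
import HarnessLib

/-!
# Linear changes of variables on the unipotent radical `U_c(F) ≅ F^{I × J}` of a two-block parabolic
# of `GL_n(F)`, at the level of Haar MEASURE: `Ad(p)` has module `‖det K_p‖_F`, the twisted
# commutator `u ↦ u p u⁻¹ p⁻¹` has module `‖det(1 - K_p)‖_F`; product-integral forms on `X × U_c`

Topic `NumberTheory/Automorphic`; namespace `Literature.NumberTheory.Automorphic`. KERNEL
mathematics only: theorems, no definition, no named fact, no instance, no `sorry`. Road «D-S1»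
(Rogawski 1990, Lemma 4.13.1 and its proof p. 70) for `G = GL_n(F)`, `F` a non-archimedean local
field, `P_c = M_c U_c` a TWO-block parabolic (`c : n → Bool`); `K_p` is the matrix of `Ad(p)` on the
box `𝔲 ≅ F^{I × J}`, `(K_p)_{(i,j),(i',j')} = p_{i i'} (p⁻¹)_{j' j}` (`parabolic_conj_boxChart`). The
brick `GLnTwoBlockUnipotentChangeOfVariables` proves the substitutions as identities of INTEGRALS over
`U_c ≤ P_c`; here they are lifted to identities of MEASURES on `U_c ≤ GL_n` and to product integrals
over `X × U_c` valid for EVERY integrand (transport along measurable equivalences: no measurability,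
integrability or Fubini hypothesis), the form consumed by the descent of orbital integrals
(`GLnLeviQuotientIwasawaIntegration`, `GLnBlockScalarOrbitalIntegral`).

* §1 `exists_boxChart_linearHomeomorph_unipotentRadicalGL` — the master lemma: a box chart `Φ` of
  `U_c` (`Φ(x) = 1 + X`, additive) such that EVERY matrix `L` on the box with `det L ≠ 0` is realised
  by a homeomorphism `T_L` of `U_c(F)` (`T_L(Φ x) = Φ(L x)`) with **`(T_L)_* μ_U = ‖det L‖_F⁻¹ · μ_U`**
  (Weil: the module of a linear automorphism of `F^{I × J}` is `‖det‖_F`,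
  `Weil1964.map_linearMap_pi_eq_smul`; `exists_haar_unipotentRadicalP_eq_smul_map_boxChart`).
* §2 `det_boxAd_mul_det_boxAd_inv` — `det K_p · det K_{p⁻¹} = 1`;
  `exists_homeomorph_unipotentRadicalGL_parabolic_conj` — **`Ad(p)`: `T(u) = p u p⁻¹`,
  `T_* μ_U = ‖det K_p‖_F⁻¹ μ_U`** (the modulus `δ_P(p)` in box form, Bernstein–Zelevinsky 1977, 1.7);
  `exists_homeomorph_unipotentRadicalGL_conj_eq` — **the twisted commutator: `u p u⁻¹ = T(u) p`,
  `T_* μ_U = ‖det(1 - K_p)‖_F⁻¹ μ_U`** when `det(1 - K_p) ≠ 0` (Rogawski's «change of variables», p. 70).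
* §3 `integral_prod_unipotent_conj_eq_smul`, `integral_prod_unipotent_mul_parabolic_eq_smul` — for ANY
  s-finite `κ` on `X`, `g : X → GL_n(F)` and EVERY `f : GL_n(F) → E`:
  **`∫_{X × U_c} f(g u p u⁻¹ g⁻¹) = ‖det(1 - K_p)‖⁻¹ ∫_{X × U_c} f(g (u p) g⁻¹)`** and
  **`∫_{X × U_c} f(g (u p) g⁻¹) = ‖det K_p‖ ∫_{X × U_c} f(g (p u) g⁻¹)`** (`g = g(x)`).

## References

* [Rogawski1990] J. D. Rogawski, *Automorphic Representations of Unitary Groups in Three Variables*,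
  Ann. of Math. Stud. 123 (1990), §4.13, Lemma 4.13.1 and proof p. 70 («by a change of variables»).
* [WeilBNT1967] A. Weil, *Basic Number Theory* (1967), Ch. I §2 Th. 3 Cor. 3; [BernsteinZelevinsky1977] 1.7.
-/

noncomputable section

open scoped MatrixGroups NNReal ENNReal
open MeasureTheory Measure Matrix Topology

namespace Literature.NumberTheory.Automorphic

open Literature.NumberTheory.GaloisRepresentations.IsNonarchimedeanLocalField

variable {F : Type*} [Field F] [ValuativeRel F] [TopologicalSpace F] [IsNonarchimedeanLocalField F]
  [MeasurableSpace F] [BorelSpace F]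
  {n : Type*} [Fintype n] [DecidableEq n] {c : n → Bool}
  {E : Type*} [NormedAddCommGroup E] [NormedSpace ℝ E]

/-! ### 1. The master lemma: linear automorphisms of the box act on Haar measure by `‖det‖_F⁻¹` -/

/-- **Linear changes of variables on `U_c(F)` in a box chart.** For every Haar measure `μ_U` on the
unipotent radical `U_c(F) ≤ GL_n(F)` of a two-block parabolic there is a box chart
`Φ : F^{I × J} ≃ₜ (U_c ≤ P_c)` (`Φ(x) = 1 + X`, `Φ(x + y) = Φ(x) Φ(y)`) such that every matrix `L` on
the box with `det L ≠ 0` is realised by a homeomorphism `T` of `U_c(F)` — `T(u) = Φ(L x)` whenever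
`u = Φ(x)` — with `T_* μ_U = ‖det L‖_F⁻¹ · μ_U` (Weil 1967, Ch. I §2: `μ_U` is a multiple of the image of
`dx = ⊗ μ_F` and `(x ↦ L x)_* dx = ‖det L‖_F⁻¹ dx`). [cite: WeilBNT1967, Chap. I §2, Th. 3 Cor. 3] -/
theorem exists_boxChart_linearHomeomorph_unipotentRadicalGL
    [MeasurableSpace ↥(unipotentRadicalGL F c)] [BorelSpace ↥(unipotentRadicalGL F c)]
    (ν : Measure ↥(unipotentRadicalGL F c)) [IsHaarMeasure ν] :
    ∃ Φ : ({i : n // c i = false} × {j : n // c j = true} → F) ≃ₜ ↥(unipotentRadicalP F c),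
      (∀ x (i j : n), (((Φ x : standardParabolicGL F c) : GL n F) : Matrix n n F) i j =
          (if i = j then 1 else 0) +
            if h : c i = false ∧ c j = true then x (⟨i, h.1⟩, ⟨j, h.2⟩) else 0) ∧
      (∀ x y, Φ (x + y) = Φ x * Φ y) ∧
      ∀ L : Matrix ({i : n // c i = false} × {j : n // c j = true})
          ({i : n // c i = false} × {j : n // c j = true}) F, L.det ≠ 0 →
        ∃ T : ↥(unipotentRadicalGL F c) ≃ₜ ↥(unipotentRadicalGL F c),
          (∀ (u : ↥(unipotentRadicalGL F c)) (x : {i : n // c i = false} × {j : n // c j = true} → F),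
              ((Φ x : standardParabolicGL F c) : GL n F) = (u : GL n F) →
              (T u : GL n F) = ((Φ (Matrix.toLin' L x) : standardParabolicGL F c) : GL n F)) ∧
          Measure.map T ν = ((normAbs F (L.det)⁻¹ : ℝ≥0) : ℝ≥0∞) • ν := by
  classical
  haveI : T2Space F := (isLocalField F).toT2Space
  haveI : SecondCountableTopology F := secondCountableTopology_localField F
  haveI : LocallyCompactSpace F := (isLocalField F).toLocallyCompactSpace
  -- `U_c` (a subgroup of `GL_n`) ≃ `unipotentRadicalP` (a subgroup of `P_c`), as groups and spaces
  have hmem : ∀ x : ↥(unipotentRadicalGL F c),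
      (⟨x.1, unipotentRadicalGL_le F c x.2⟩ : standardParabolicGL F c) ∈ unipotentRadicalP F c :=
    fun x => by rw [← unipotentRadicalGL_subgroupOf, Subgroup.mem_subgroupOf]; exact x.2
  have hmem' : ∀ p : standardParabolicGL F c, p ∈ unipotentRadicalP F c →
      (p : GL n F) ∈ unipotentRadicalGL F c := fun p hp => by
    rw [← unipotentRadicalGL_subgroupOf, Subgroup.mem_subgroupOf] at hp
    exact hp
  let h₂ : ↥(unipotentRadicalGL F c) ≃ₜ ↥(unipotentRadicalP F c) :=
  { toFun := fun x => ⟨⟨x.1, unipotentRadicalGL_le F c x.2⟩, hmem x⟩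
    invFun := fun y => ⟨y.1.1, hmem' y.1 y.2⟩
    left_inv := fun x => rfl
    right_inv := fun y => rfl
    continuous_toFun := (continuous_subtype_val.subtype_mk _).subtype_mk _
    continuous_invFun := (continuous_subtype_val.comp continuous_subtype_val).subtype_mk _ }
  let h₂m : ↥(unipotentRadicalGL F c) ≃* ↥(unipotentRadicalP F c) :=
  { h₂.toEquiv with map_mul' := fun x y => Subtype.ext (Subtype.ext rfl) }
  have h₂m_coe : ⇑h₂m = ⇑h₂ := rfl
  letI mP : MeasurableSpace ↥(unipotentRadicalP F c) := borel _
  haveI : BorelSpace ↥(unipotentRadicalP F c) := ⟨rfl⟩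
  set ν' : Measure ↥(unipotentRadicalP F c) := Measure.map h₂ ν with hν'
  haveI : IsHaarMeasure ν' := by
    rw [hν', ← h₂m_coe]
    exact h₂m.isHaarMeasure_map ν h₂.continuous h₂.symm.continuous
  obtain ⟨Φ, κ₀, hΦ, hΦadd, hν'Φ⟩ := exists_haar_unipotentRadicalP_eq_smul_map_boxChart ν'
  refine ⟨Φ, hΦ, hΦadd, fun L hL => ?_⟩
  have hdet : LinearMap.det (Matrix.toLin' L) ≠ 0 := by rwa [LinearMap.det_toLin']
  set e := LinearMap.equivOfDetNeZero _ hdet with he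
  have hecoe : (e : ({i : n // c i = false} × {j : n // c j = true} → F) →ₗ[F]
      ({i : n // c i = false} × {j : n // c j = true} → F)) = Matrix.toLin' L :=
    LinearEquiv.coe_ofIsUnitDet _
  have heapp : ∀ x, e x = Matrix.toLin' L x := fun x => by
    rw [← LinearEquiv.coe_coe, hecoe]
  have hdet_e : LinearMap.det (e : ({i : n // c i = false} × {j : n // c j = true} → F) →ₗ[F]
      ({i : n // c i = false} × {j : n // c j = true} → F)) = L.det := by
    rw [hecoe, LinearMap.det_toLin']
  let eh : ({i : n // c i = false} × {j : n // c j = true} → F) ≃ₜ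
      ({i : n // c i = false} × {j : n // c j = true} → F) :=
  { e.toEquiv with
    continuous_toFun := (e : ({i : n // c i = false} × {j : n // c j = true} → F) →ₗ[F]
      ({i : n // c i = false} × {j : n // c j = true} → F)).continuous_on_pi
    continuous_invFun := (e.symm : ({i : n // c i = false} × {j : n // c j = true} → F) →ₗ[F]
      ({i : n // c i = false} × {j : n // c j = true} → F)).continuous_on_pi }
  have eh_apply : ∀ x, eh x = Matrix.toLin' L x := heapp
  let T : ↥(unipotentRadicalGL F c) ≃ₜ ↥(unipotentRadicalGL F c) :=
    h₂.trans (((Φ.symm.trans eh).trans Φ).trans h₂.symm)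
  have T_apply : ∀ u, T u = h₂.symm (Φ (eh (Φ.symm (h₂ u)))) := fun u => rfl
  refine ⟨T, fun u x hux => ?_, ?_⟩
  · -- `T (Φ x) = Φ (L x)`
    have hx : Φ.symm (h₂ u) = x := by
      rw [Homeomorph.symm_apply_eq]
      exact Subtype.ext (Subtype.ext hux.symm)
    rw [T_apply, hx, eh_apply]
    rfl
  · -- `T_* ν = ‖det L‖⁻¹ • ν`
    have hmΦ : Measurable (Φ : _ → ↥(unipotentRadicalP F c)) := Φ.continuous.measurable
    have hmΦs : Measurable (Φ.symm : ↥(unipotentRadicalP F c) → _) := Φ.symm.continuous.measurable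
    have hmh₂ : Measurable (h₂ : _ → ↥(unipotentRadicalP F c)) := h₂.continuous.measurable
    have hmh₂s : Measurable (h₂.symm : _ → ↥(unipotentRadicalGL F c)) := h₂.symm.continuous.measurable
    have hme : Measurable (eh : _ → _) := eh.continuous.measurable
    have hT : (T : ↥(unipotentRadicalGL F c) → ↥(unipotentRadicalGL F c)) =
        (h₂.symm ∘ Φ ∘ eh) ∘ (Φ.symm ∘ h₂) := by
      funext u; rfl
    have hg : Measurable (h₂.symm ∘ Φ ∘ eh : _ → ↥(unipotentRadicalGL F c)) :=
      hmh₂s.comp (hmΦ.comp hme)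
    have hν : ν = Measure.map h₂.symm ν' := by
      rw [hν', Measure.map_map hmh₂s hmh₂]
      have : (h₂.symm ∘ h₂ : ↥(unipotentRadicalGL F c) → ↥(unipotentRadicalGL F c)) = id := by
        funext u; exact h₂.symm_apply_apply u
      rw [this, Measure.map_id]
    have hmap_e : Measure.map (eh : _ → ({i : n // c i = false} × {j : n // c j = true} → F))
        (Measure.pi fun _ => (Measure.addHaar : Measure F)) =
        ((normAbs F (L.det)⁻¹ : ℝ≥0) : ℝ≥0∞) • Measure.pi fun _ => (Measure.addHaar : Measure F) := by
      have hfun : (eh : _ → ({i : n // c i = false} × {j : n // c j = true} → F)) =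
          ((e : ({i : n // c i = false} × {j : n // c j = true} → F) →ₗ[F]
            ({i : n // c i = false} × {j : n // c j = true} → F)) : _ → _) := by
        funext x; rw [eh_apply, hecoe]
      have hdet' : LinearMap.det (e : ({i : n // c i = false} × {j : n // c j = true} → F) →ₗ[F]
          ({i : n // c i = false} × {j : n // c j = true} → F)) ≠ 0 := by rwa [hdet_e]
      rw [hfun, Weil1964.map_linearMap_pi_eq_smul Measure.addHaar hdet', hdet_e]
    calc Measure.map T ν
        = Measure.map (h₂.symm ∘ Φ ∘ eh) (Measure.map (Φ.symm ∘ h₂) ν) := by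
          rw [hT, Measure.map_map hg (hmΦs.comp hmh₂)]
      _ = Measure.map (h₂.symm ∘ Φ ∘ eh) (Measure.map Φ.symm ν') := by
          rw [← Measure.map_map hmΦs hmh₂, ← hν']
      _ = Measure.map (h₂.symm ∘ Φ ∘ eh)
            (κ₀ • Measure.pi fun _ => (Measure.addHaar : Measure F)) := by
          rw [hν'Φ, Measure.map_smul, Measure.map_map hmΦs hmΦ]
          have : (Φ.symm ∘ Φ : _ → ({i : n // c i = false} × {j : n // c j = true} → F)) = id := by
            funext x; exact Φ.symm_apply_apply x
          rw [this, Measure.map_id]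
      _ = κ₀ • Measure.map (h₂.symm ∘ Φ) (Measure.map eh
            (Measure.pi fun _ => (Measure.addHaar : Measure F))) := by
          rw [Measure.map_smul, Measure.map_map (hmh₂s.comp hmΦ) hme]
          rfl
      _ = ((normAbs F (L.det)⁻¹ : ℝ≥0) : ℝ≥0∞) • (κ₀ • Measure.map (h₂.symm ∘ Φ)
            (Measure.pi fun _ => (Measure.addHaar : Measure F))) := by
          rw [hmap_e, Measure.map_smul, smul_comm]
      _ = ((normAbs F (L.det)⁻¹ : ℝ≥0) : ℝ≥0∞) • ν := by
          rw [hν, hν'Φ, Measure.map_smul, Measure.map_map hmh₂s hmΦ]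

/-! ### 2. `Ad(p)` and the twisted commutator as homeomorphisms of `U_c(F)` with their modules -/

omit [MeasurableSpace F] [BorelSpace F] in
/-- **`det K_p · det K_{p⁻¹} = 1`**: the matrices of `Ad(p)` and `Ad(p⁻¹)` on the box are mutually
inverse (`p (p⁻¹ Φ(x) p) p⁻¹ = Φ(x)`, `parabolic_conj_boxChart`, box coordinates being injective);
in particular `det K_p ≠ 0` for every `p ∈ P_c(F)`. [cite: BernsteinZelevinsky1977, §2.1] -/
theorem det_boxAd_mul_det_boxAd_inv (p : standardParabolicGL F c) :
    (Matrix.of fun q q' : {i : n // c i = false} × {j : n // c j = true} =>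
        ((p : GL n F) : Matrix n n F) q.1 q'.1 *
          (((p⁻¹ : standardParabolicGL F c) : GL n F) : Matrix n n F) q'.2 q.2).det *
      (Matrix.of fun q q' : {i : n // c i = false} × {j : n // c j = true} =>
        (((p⁻¹ : standardParabolicGL F c) : GL n F) : Matrix n n F) q.1 q'.1 *
          ((p : GL n F) : Matrix n n F) q'.2 q.2).det = 1 := by
  classical
  obtain ⟨Φ, hΦ, -, -⟩ := exists_boxHomeomorph_unipotentRadicalP F c
  have h1 := fun x => parabolic_conj_boxChart (Φ : _ → ↥(unipotentRadicalP F c)) hΦ p⁻¹ x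
  have h2 := fun x => parabolic_conj_boxChart (Φ : _ → ↥(unipotentRadicalP F c)) hΦ p x
  simp only [inv_inv] at h1
  generalize (Matrix.of fun q q' : {i : n // c i = false} × {j : n // c j = true} =>
      ((p : GL n F) : Matrix n n F) q.1 q'.1 *
        (((p⁻¹ : standardParabolicGL F c) : GL n F) : Matrix n n F) q'.2 q.2) = K at h2 ⊢
  generalize (Matrix.of fun q q' : {i : n // c i = false} × {j : n // c j = true} =>
      (((p⁻¹ : standardParabolicGL F c) : GL n F) : Matrix n n F) q.1 q'.1 *
        ((p : GL n F) : Matrix n n F) q'.2 q.2) = K' at h1 ⊢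
  have hcomp : ∀ x, Matrix.toLin' K (Matrix.toLin' K' x) = x := by
    intro x
    apply Φ.injective
    apply Subtype.ext
    rw [← h2 (Matrix.toLin' K' x), ← h1 x]
    group
  have hKK' : K * K' = 1 := by
    apply (Matrix.toLin' (R := F)).injective
    rw [Matrix.toLin'_mul, Matrix.toLin'_one]
    exact LinearMap.ext hcomp
  rw [← Matrix.det_mul, hKK', Matrix.det_one]

/-- **`Ad(p)` on `U_c(F)` is a homeomorphism of module `‖det K_p‖_F`**: for `p ∈ P_c(F)` there is a
homeomorphism `T` of `U_c(F)` with `T(u) = p u p⁻¹` and `T_* μ_U = ‖det K_p‖_F⁻¹ · μ_U` for every Haar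
measure `μ_U` (in the box chart `T = K_p`, `parabolic_conj_boxChart`), and `det K_p ≠ 0`. Thus
`‖det K_p‖_F` is the modulus `δ_P(p)|_{U_c}` of the two-block parabolic in box form
(Bernstein–Zelevinsky 1977, 1.7; cf. `modularCharacter_standardParabolicGL_bool`). [cite: BernsteinZelevinsky1977, 1.7] -/
theorem exists_homeomorph_unipotentRadicalGL_parabolic_conj
    [MeasurableSpace ↥(unipotentRadicalGL F c)] [BorelSpace ↥(unipotentRadicalGL F c)]
    (ν : Measure ↥(unipotentRadicalGL F c)) [IsHaarMeasure ν] (p : standardParabolicGL F c) :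
    ∃ T : ↥(unipotentRadicalGL F c) ≃ₜ ↥(unipotentRadicalGL F c),
      (∀ u : ↥(unipotentRadicalGL F c),
        (T u : GL n F) = (p : GL n F) * (u : GL n F) * (p : GL n F)⁻¹) ∧
      (Matrix.of fun q q' : {i : n // c i = false} × {j : n // c j = true} =>
          ((p : GL n F) : Matrix n n F) q.1 q'.1 *
            (((p⁻¹ : standardParabolicGL F c) : GL n F) : Matrix n n F) q'.2 q.2).det ≠ 0 ∧
      Measure.map T ν =
        ((normAbs F ((Matrix.of fun q q' : {i : n // c i = false} × {j : n // c j = true} =>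
          ((p : GL n F) : Matrix n n F) q.1 q'.1 *
            (((p⁻¹ : standardParabolicGL F c) : GL n F) : Matrix n n F) q'.2 q.2).det)⁻¹ :
          ℝ≥0) : ℝ≥0∞) • ν := by
  classical
  have hdetp := det_boxAd_mul_det_boxAd_inv p
  obtain ⟨Φ, hΦ, -, hlin⟩ := exists_boxChart_linearHomeomorph_unipotentRadicalGL ν
  have hconj := fun x => parabolic_conj_boxChart (Φ : _ → ↥(unipotentRadicalP F c)) hΦ p x
  generalize (Matrix.of fun q q' : {i : n // c i = false} × {j : n // c j = true} =>
      ((p : GL n F) : Matrix n n F) q.1 q'.1 *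
        (((p⁻¹ : standardParabolicGL F c) : GL n F) : Matrix n n F) q'.2 q.2) = K at hconj hdetp ⊢
  have hK : K.det ≠ 0 := fun h0 => by simp [h0] at hdetp
  obtain ⟨T, hT, hTν⟩ := hlin K hK
  refine ⟨T, fun u => ?_, hK, hTν⟩
  -- `u = Φ x` for `x = Φ⁻¹ (u, as an element of U_c ≤ P_c)`
  have huP : (⟨(u : GL n F), unipotentRadicalGL_le F c u.2⟩ : standardParabolicGL F c) ∈
      unipotentRadicalP F c := by
    rw [← unipotentRadicalGL_subgroupOf, Subgroup.mem_subgroupOf]; exact u.2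
  set x := Φ.symm ⟨⟨(u : GL n F), unipotentRadicalGL_le F c u.2⟩, huP⟩ with hx
  have hux : ((Φ x : standardParabolicGL F c) : GL n F) = (u : GL n F) := by
    rw [hx, Homeomorph.apply_symm_apply]
  rw [hT u x hux, ← hconj x, Subgroup.coe_mul, Subgroup.coe_mul, Subgroup.coe_inv, hux]

/-- **The twisted commutator on `U_c(F)` is a homeomorphism of module `‖det(1 - K_p)‖_F`**: for
`p ∈ P_c(F)` with `det(1 - K_p) ≠ 0` there is a homeomorphism `T` of `U_c(F)` with `u p u⁻¹ = T(u) · p`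
(so `T(u) = u p u⁻¹ p⁻¹`; in the box chart `T = 1 - K_p`, `boxChart_mul_conj_eq`) and
`T_* μ_U = ‖det(1 - K_p)‖_F⁻¹ · μ_U` for every Haar measure `μ_U` (Rogawski 1990, proof of Lemma 4.13.1
p. 70: «by a change of variables»). [cite: Rogawski1990, §4.13, proof of Lemma 4.13.1, p. 70] -/
theorem exists_homeomorph_unipotentRadicalGL_conj_eq
    [MeasurableSpace ↥(unipotentRadicalGL F c)] [BorelSpace ↥(unipotentRadicalGL F c)]
    (ν : Measure ↥(unipotentRadicalGL F c)) [IsHaarMeasure ν] (p : standardParabolicGL F c)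
    (hp : (1 - Matrix.of fun q q' : {i : n // c i = false} × {j : n // c j = true} =>
          ((p : GL n F) : Matrix n n F) q.1 q'.1 *
            (((p⁻¹ : standardParabolicGL F c) : GL n F) : Matrix n n F) q'.2 q.2).det ≠ 0) :
    ∃ T : ↥(unipotentRadicalGL F c) ≃ₜ ↥(unipotentRadicalGL F c),
      (∀ u : ↥(unipotentRadicalGL F c),
        (u : GL n F) * (p : GL n F) * (u : GL n F)⁻¹ = (T u : GL n F) * (p : GL n F)) ∧
      Measure.map T ν =
        ((normAbs F ((1 - Matrix.of fun q q' : {i : n // c i = false} × {j : n // c j = true} =>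
          ((p : GL n F) : Matrix n n F) q.1 q'.1 *
            (((p⁻¹ : standardParabolicGL F c) : GL n F) : Matrix n n F) q'.2 q.2).det)⁻¹ :
          ℝ≥0) : ℝ≥0∞) • ν := by
  classical
  obtain ⟨Φ, hΦ, hΦadd, hlin⟩ := exists_boxChart_linearHomeomorph_unipotentRadicalGL ν
  have hconj := fun x => boxChart_mul_conj_eq (Φ : _ → ↥(unipotentRadicalP F c)) hΦ hΦadd p x
  generalize (1 - Matrix.of fun q q' : {i : n // c i = false} × {j : n // c j = true} =>
      ((p : GL n F) : Matrix n n F) q.1 q'.1 *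
        (((p⁻¹ : standardParabolicGL F c) : GL n F) : Matrix n n F) q'.2 q.2) = L at hconj hp ⊢
  obtain ⟨T, hT, hTν⟩ := hlin L hp
  refine ⟨T, fun u => ?_, hTν⟩
  have huP : (⟨(u : GL n F), unipotentRadicalGL_le F c u.2⟩ : standardParabolicGL F c) ∈
      unipotentRadicalP F c := by
    rw [← unipotentRadicalGL_subgroupOf, Subgroup.mem_subgroupOf]; exact u.2
  set x := Φ.symm ⟨⟨(u : GL n F), unipotentRadicalGL_le F c u.2⟩, huP⟩ with hx
  have hux : ((Φ x : standardParabolicGL F c) : GL n F) = (u : GL n F) := by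
    rw [hx, Homeomorph.apply_symm_apply]
  have h := congrArg (fun q : standardParabolicGL F c => (q : GL n F)) (hconj x)
  simp only [Subgroup.coe_mul, Subgroup.coe_inv, hux] at h
  rw [hT u x hux]
  exact h

/-! ### 3. Product-integral forms on `X × U_c`, no integrability needed -/

omit [ValuativeRel F] [IsNonarchimedeanLocalField F] [MeasurableSpace F] [BorelSpace F] in
/-- Transport of a product integral along `id × T` for a homeomorphism `T` of `U_c(F)` scaling the
measure by `J`: `∫ G(x, T u) d(κ ⊗ μ_U) = J ∫ G d(κ ⊗ μ_U)` for EVERY `G` (`integral_map_equiv`). [folklore] -/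
private theorem integral_prod_comp_homeomorph_eq_smul {X : Type*} [MeasurableSpace X]
    (κ : Measure X) [SFinite κ]
    [MeasurableSpace ↥(unipotentRadicalGL F c)] [BorelSpace ↥(unipotentRadicalGL F c)]
    (ν : Measure ↥(unipotentRadicalGL F c)) [SFinite ν]
    (T : ↥(unipotentRadicalGL F c) ≃ₜ ↥(unipotentRadicalGL F c)) {J : ℝ≥0}
    (hTν : Measure.map T ν = (J : ℝ≥0∞) • ν) (G : X × ↥(unipotentRadicalGL F c) → E) :
    ∫ q, G (q.1, T q.2) ∂(κ.prod ν) = (J : ℝ) • ∫ q, G q ∂(κ.prod ν) := by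
  set Ψ : X × ↥(unipotentRadicalGL F c) ≃ᵐ X × ↥(unipotentRadicalGL F c) :=
    (MeasurableEquiv.refl X).prodCongr T.toMeasurableEquiv with hΨdef
  have hΨ : Measure.map Ψ (κ.prod ν) = (J : ℝ≥0∞) • κ.prod ν := by
    rw [show (Ψ : X × ↥(unipotentRadicalGL F c) → _) = Prod.map id T from funext fun q => rfl,
      ← Measure.map_prod_map κ ν measurable_id T.continuous.measurable, Measure.map_id, hTν,
      Measure.prod_smul_right]
  have key := integral_map_equiv (μ := κ.prod ν) Ψ G
  rw [hΨ, integral_smul_measure, ENNReal.coe_toReal] at key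
  exact key.symm

omit [MeasurableSpace F] [BorelSpace F] in
/-- `U_c(F)` is locally compact and second countable, so a Haar measure on it is s-finite. [folklore] -/
private theorem sFinite_haar_unipotentRadicalGL
    [MeasurableSpace ↥(unipotentRadicalGL F c)] [BorelSpace ↥(unipotentRadicalGL F c)]
    (ν : Measure ↥(unipotentRadicalGL F c)) [IsHaarMeasure ν] : SFinite ν := by
  haveI : T2Space F := (isLocalField F).toT2Space
  haveI : SecondCountableTopology F := secondCountableTopology_localField F
  haveI : LocallyCompactSpace F := (isLocalField F).toLocallyCompactSpace
  obtain ⟨Φ, -, -⟩ := exists_boxHomeomorph_unipotentRadicalGL (R := F) c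
  haveI := Φ.symm.isClosedEmbedding.locallyCompactSpace
  haveI := Φ.symm.secondCountableTopology
  infer_instance

/-- **`∫_{X × U_c} f(g(x) · u p u⁻¹ · g(x)⁻¹) d(κ ⊗ μ_U) = ‖det(1 - K_p)‖_F⁻¹ ∫_{X × U_c} f(g(x) · (u p) · g(x)⁻¹) d(κ ⊗ μ_U)`**
for every s-finite measure `κ` on `X`, every `g : X → GL_n(F)`, every Haar measure `μ_U` on `U_c(F)`,
every `p ∈ P_c(F)` with `det(1 - K_p) ≠ 0` and EVERY `f` (no measurability or integrability needed).
With `X = K = GL_n(𝒪)` this is the unipotent step of Rogawski's descent (proof of Lemma 4.13.1,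
p. 70). [cite: Rogawski1990, §4.13, proof of Lemma 4.13.1, p. 70] -/
theorem integral_prod_unipotent_conj_eq_smul {X : Type*} [MeasurableSpace X] (κ : Measure X)
    [SFinite κ] (g : X → GL n F)
    [MeasurableSpace ↥(unipotentRadicalGL F c)] [BorelSpace ↥(unipotentRadicalGL F c)]
    (ν : Measure ↥(unipotentRadicalGL F c)) [IsHaarMeasure ν] (p : standardParabolicGL F c)
    (hp : (1 - Matrix.of fun q q' : {i : n // c i = false} × {j : n // c j = true} =>
          ((p : GL n F) : Matrix n n F) q.1 q'.1 *
            (((p⁻¹ : standardParabolicGL F c) : GL n F) : Matrix n n F) q'.2 q.2).det ≠ 0)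
    (f : GL n F → E) :
    ∫ q : X × ↥(unipotentRadicalGL F c),
        f (g q.1 * (q.2 : GL n F) * (p : GL n F) * (g q.1 * (q.2 : GL n F))⁻¹) ∂(κ.prod ν) =
      ((normAbs F ((1 - Matrix.of fun q q' : {i : n // c i = false} × {j : n // c j = true} =>
          ((p : GL n F) : Matrix n n F) q.1 q'.1 *
            (((p⁻¹ : standardParabolicGL F c) : GL n F) : Matrix n n F) q'.2 q.2).det)⁻¹ :
          ℝ≥0) : ℝ) •
        ∫ q : X × ↥(unipotentRadicalGL F c),
          f (g q.1 * ((q.2 : GL n F) * (p : GL n F)) * (g q.1)⁻¹) ∂(κ.prod ν) := by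
  haveI : SFinite ν := sFinite_haar_unipotentRadicalGL ν
  obtain ⟨T, hT, hTν⟩ := exists_homeomorph_unipotentRadicalGL_conj_eq ν p hp
  rw [← integral_prod_comp_homeomorph_eq_smul κ ν T hTν]
  refine integral_congr_ae (ae_of_all _ fun q => ?_)
  simp only
  rw [← hT q.2, _root_.mul_inv_rev, ← mul_assoc, mul_assoc (g q.1), mul_assoc (g q.1),
    mul_assoc (q.2 : GL n F)]

/-- **`∫_{X × U_c} f(g(x) · (u p) · g(x)⁻¹) d(κ ⊗ μ_U) = ‖det K_p‖_F · ∫_{X × U_c} f(g(x) · (p u) · g(x)⁻¹) d(κ ⊗ μ_U)`**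
for every s-finite `κ` on `X`, every `g : X → GL_n(F)`, every Haar measure `μ_U` on `U_c(F)`, every
`p ∈ P_c(F)` and EVERY `f` (`u p = p · (p⁻¹ u p)`; transport along `id × Ad(p⁻¹)`,
`exists_homeomorph_unipotentRadicalGL_parabolic_conj`, `det K_{p⁻¹} = (det K_p)⁻¹`). This is the
modulus `δ_P(p)` turning `∫_U f(… u p …)` into the constant-term shape `∫_U f(… p u …)`
(Rogawski 1990, p. 70). [cite: Rogawski1990, §4.13, proof of Lemma 4.13.1, p. 70] -/
theorem integral_prod_unipotent_mul_parabolic_eq_smul {X : Type*} [MeasurableSpace X] (κ : Measure X)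
    [SFinite κ] (g : X → GL n F)
    [MeasurableSpace ↥(unipotentRadicalGL F c)] [BorelSpace ↥(unipotentRadicalGL F c)]
    (ν : Measure ↥(unipotentRadicalGL F c)) [IsHaarMeasure ν] (p : standardParabolicGL F c)
    (f : GL n F → E) :
    ∫ q : X × ↥(unipotentRadicalGL F c),
        f (g q.1 * ((q.2 : GL n F) * (p : GL n F)) * (g q.1)⁻¹) ∂(κ.prod ν) =
      ((normAbs F (Matrix.of fun q q' : {i : n // c i = false} × {j : n // c j = true} =>
          ((p : GL n F) : Matrix n n F) q.1 q'.1 *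
            (((p⁻¹ : standardParabolicGL F c) : GL n F) : Matrix n n F) q'.2 q.2).det : ℝ≥0) : ℝ) •
        ∫ q : X × ↥(unipotentRadicalGL F c),
          f (g q.1 * ((p : GL n F) * (q.2 : GL n F)) * (g q.1)⁻¹) ∂(κ.prod ν) := by
  haveI : SFinite ν := sFinite_haar_unipotentRadicalGL ν
  obtain ⟨T, hT, -, hTν⟩ := exists_homeomorph_unipotentRadicalGL_parabolic_conj ν p⁻¹
  have hdet := det_boxAd_mul_det_boxAd_inv p
  simp only [inv_inv] at hT hTν
  generalize (Matrix.of fun q q' : {i : n // c i = false} × {j : n // c j = true} =>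
      ((p : GL n F) : Matrix n n F) q.1 q'.1 *
        (((p⁻¹ : standardParabolicGL F c) : GL n F) : Matrix n n F) q'.2 q.2) = K at hdet ⊢
  generalize (Matrix.of fun q q' : {i : n // c i = false} × {j : n // c j = true} =>
      (((p⁻¹ : standardParabolicGL F c) : GL n F) : Matrix n n F) q.1 q'.1 *
        ((p : GL n F) : Matrix n n F) q'.2 q.2) = K' at hdet hTν
  have hK' : (K'.det)⁻¹ = K.det := by
    rw [← mul_eq_one_iff_inv_eq₀ (fun h0 => by simp [h0] at hdet), mul_comm, hdet]
  rw [hK'] at hTν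
  rw [← integral_prod_comp_homeomorph_eq_smul κ ν T hTν]
  refine integral_congr_ae (ae_of_all _ fun q => ?_)
  have hgrp : (p : GL n F) * ((p : GL n F)⁻¹ * (q.2 : GL n F) * (p : GL n F)) =
      (q.2 : GL n F) * (p : GL n F) := by group
  simp only
  rw [hT q.2, Subgroup.coe_inv, inv_inv, hgrp]

end Literature.NumberTheory.Automorphic
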